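import Literature.NumberTheory.EllipticCurves.Szpiro
import Literature.NumberTheory.EllipticCurves.SzpiroOfAbcProofs
import Literature.NumberTheory.DiophantineGeometry.MinimalDiscriminantProofs
import Summits.ABC.Statement
import HarnessLib
import HarnessLib.Audit

/-!
# ABC — SUB-SUMMIT rung A-PS: polynomial Szpiro over `ℚ` (the Prop; proof-free)

SUB-SUMMIT rung A-PS (HUMAN D-0139/D-0140, 2026-08-27): NOT abc; a first polynomial bound would
supersede Stewart–Yu's exponential bound; stature 200 / 350–400 effective (LADDER-ABC §1 rung A-PS).
`abc ⇒ Szpiro 6+ε ⇒ A-PS` (both links PROVED below from tree theorems); A-PS for large `K` is NOT abc.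
Typed ≠ proved: `PolySzpiroRat` / `PolySzpiroRatEff` are OPEN statements (obligation nodes), used only as
hypotheses / targets. In print this is Pasten's "simpler formulation" of Szpiro's conjecture: "There is a
constant `κ > 0` such that for all elliptic curves `E` over `ℚ` we have `Δ_E < N_E^κ`" (Pasten 2024,
Conj. 1.1; equivalent to the present log-form with an additive constant, `polySzpiroRat_of_lt_rpow` one way).
Vocabulary: `|Δ_min(E)| = W.minimalDiscriminantNorm ℤ`, `N(E) = W.conductorNorm ℤ` (tree, `WeierstrassCurve.*`,
the currency of `Literature.NumberTheory.EllipticCurves.SzpiroConjecture`), any model `W` of `E` (both are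
isomorphism invariants: `conductorNorm_smul_rat`, `minimalDiscriminantNorm_smul_rat`). Comparison constants for
the A1 rung: Stewart–Yu give `log|Δ_min| ≪ N^{1/3} (log N)^3` (tree `stewart_yu_holds`, via abc triples), the
modular method `log|Δ_min| < N log N + O(N log log N)` (`MurtyPasten.log_minimalDiscriminant_lt`,
`pasten_thm_7_5`): none is polynomial in `log N`. Cell abc-an (director-abc g6-AN-D2; cited by cells abc-ff /
abc-harv and by `Summits/ABC/Analytic/Requirements*.lean`). One Prop in the tree, not three.
-/

namespace Summit.ABC

open Literature.NumberTheory.EllipticCurves WeierstrassCurve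

/-- **A-PS-eff `(K, C)`** — polynomial Szpiro over `ℚ` with EXPLICIT constants: for every elliptic curve `E/ℚ`
(any Weierstrass model `W`; both invariants are model-independent), `log |Δ_min(E)| ≤ K · log N(E) + C`.
SUB-SUMMIT rung A-PS-eff (HUMAN D-0139/D-0140, 2026-08-27): NOT abc; a first polynomial bound would supersede
Stewart–Yu's exponential bound; stature 350–400 (effective). «NOT abc — POLY-SZPIRO(E = K)».
CALIBRATION (REDUCTION CENSUS §R R2, 2026-08-27; computed ≠ proved — a calibration is a FLOOR on the admissible
explicit pairs `(K, C)`, never evidence for the statement; natural logs; `|Δ_min|` exact from Cremona's minimal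
models): over ALL 3,064,705 curves of conductor `N < 500000` in Cremona's `ecdata` (kit-staged slug
`ecdata-bff5c453d45a`; ENG-SZPIRO kit job j285518 = DESK-CALIB-1 j285151 = abc-an CALIB-1, three independent scripts
agreeing to 5 digits; Bennett–Yazdani 2012 Table 4 reproduced 11/11 to `5·10⁻¹⁵`) the Szpiro ratio
`σ = log|Δ_min|/log N` has in-range maximum `8.90370` at 1290h1 (`Δ_min = 2⁵³·3⁸·5⁹·43`), then 9510e1 `8.84313`,
279366b1 `8.83327` — so `C = 0 ⇒ K ≥ 8.90370`; with `C_min(K) := max_E (log|Δ_min| − K·log N)`: `K = 7 ⇒ C ≥ 22.99`,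
`K = 6.5 ⇒ C ≥ 29.26`, `K = 6.1 ⇒ C ≥ 34.28` (all at 279366b1), and `C = 24 ⇒ K ≥ 6.9194`. The one printed
out-of-range record `σ = 9.01996` at `N = 12735814 = 2·7·13·19·29·127` (`Δ_min = −2³³·7¹⁸·13²⁷·19³·29²·127`)
[cite: BennettYazdani2012, Table 1] lifts `K = 7` to `C ≥ 33.05` and `C = 0` to `K ≥ 9.01997`. Floors RISE with the
range: `max_E (log|Δ_min| − 6·log N)` grows `+1.69` nats per doubling of `N` (20.80 at `N ≈ 10³` → 35.53 at 279366b1;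
Masser-compatible), while the σ-envelope is flat at 8.4–8.9 and its top seven curves are all semistable (j285518).
Frey sub-family (full rational 2-torsion, 101,772 curves): `C = 0 ⇒ K ≥ 7.71401` (313215h2), `K = 7 ⇒ C ≥ 9.04` — the
least stable numbers (band maximum still growing; Nitaj's `σ = 8.81` class at `N = 2526810` lies just beyond; j285819).
Any explicit `(K, C)` below these floors is dead on arrival; `K ≤ 6` is refuted for EVERY `C` (Masser 1990; tree
`Summit.ABC.Analytic.not_polySzpiroRatEff_of_le_six`). NOT abc — POLY-SZPIRO(E).
[cite: PastenShimura2024, Conj. 1.1 (polynomial form of Szpiro's conjecture)] -/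
@[conjecture] def PolySzpiroRatEff (K C : ℝ) : Prop :=
  ∀ (W : WeierstrassCurve ℚ) [W.IsElliptic],
    Real.log (W.minimalDiscriminantNorm ℤ : ℝ) ≤ K * Real.log (W.conductorNorm ℤ : ℝ) + C

/-- **A-PS** — polynomial Szpiro over `ℚ`: `∃ K C, ∀ E/ℚ elliptic, log |Δ_min(E)| ≤ K · log N(E) + C` (ANY
fixed exponent `K`; ineffective allowed). SUB-SUMMIT rung A-PS (HUMAN D-0139/D-0140, 2026-08-27): NOT abc; a
first polynomial bound would supersede Stewart–Yu's exponential bound; stature 200. `abc ⇒ Szpiro 6+ε ⇒ A-PS`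
(`polySzpiroRat_of_szpiro`, `polySzpiroRat_of_abc`); A-PS for large `K` is NOT abc.
CALIBRATION (computed ≠ proved; see `PolySzpiroRatEff` for the table): a witnessing pair must clear the Cremona-range
floors `K ≥ 8.90370` at `C = 0` (1290h1) resp. `C ≥ 22.99` at `K = 7` (279366b1) (N < 500000; ENG-SZPIRO j285518 =
DESK-CALIB-1 j285151), and `K ≥ 9.01997` at `C = 0` once the printed record curve `N = 12735814` is included
[cite: BennettYazdani2012, Table 1] — a floor on the witnesses, silent on the truth of this `∃`-statement.
[cite: PastenShimura2024, Conj. 1.1 (polynomial form of Szpiro's conjecture)] -/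
@[conjecture] def PolySzpiroRat : Prop :=
  ∃ K C : ℝ, PolySzpiroRatEff K C

/-- A-PS-eff ⇒ A-PS (one line). [folklore] -/
theorem polySzpiroRat_of_eff {K C : ℝ} (h : PolySzpiroRatEff K C) : PolySzpiroRat := ⟨K, C, h⟩

/-- Pasten's printed form `∃ κ, ∀ E, Δ_E < N_E^κ` (Conj. 1.1) gives A-PS with `C = 0` (take logarithms;
`|Δ_min| ≥ 1`, `N ≥ 1`). [cite: PastenShimura2024, Conj. 1.1] -/
theorem polySzpiroRat_of_lt_rpow {κ : ℝ}
    (h : ∀ (W : WeierstrassCurve ℚ) [W.IsElliptic], (W.minimalDiscriminantNorm ℤ : ℝ) < (W.conductorNorm ℤ : ℝ) ^ κ) :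
    PolySzpiroRatEff κ 0 := by
  intro W _
  have hΔ : (0 : ℝ) < (W.minimalDiscriminantNorm ℤ : ℝ) := by
    exact_mod_cast (W.minimalDiscriminantNorm_pos_holds : 0 < W.minimalDiscriminantNorm ℤ)
  have hN : (0 : ℝ) < (W.conductorNorm ℤ : ℝ) := by
    exact_mod_cast (W.conductorNorm_pos_holds : 0 < W.conductorNorm ℤ)
  have := Real.log_le_log hΔ (h W).le
  rw [Real.log_rpow hN] at this
  linarith

/-- **Szpiro `6+ε` ⇒ A-PS** (`SzpiroConjecture`, Silverman AEC VIII.11.1, with `ε = 1`): `K = 7`,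
`C = log max(C₁, 1)`. Hence A-PS for `K ≥ 7` is implied by abc; NOT abc. [cite: SilvermanAEC2009, Conj. VIII.11.1] -/
theorem polySzpiroRat_of_szpiro (h : SzpiroConjecture) : PolySzpiroRat := by
  obtain ⟨C, hC⟩ := h 1 one_pos
  refine ⟨7, Real.log (max C 1), fun W _ => ?_⟩
  have hΔ : (0 : ℝ) < (W.minimalDiscriminantNorm ℤ : ℝ) := by
    exact_mod_cast (W.minimalDiscriminantNorm_pos_holds : 0 < W.minimalDiscriminantNorm ℤ)
  have hN : (0 : ℝ) < (W.conductorNorm ℤ : ℝ) := by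
    exact_mod_cast (W.conductorNorm_pos_holds : 0 < W.conductorNorm ℤ)
  have h2 : (W.minimalDiscriminantNorm ℤ : ℝ) ≤ max C 1 * (W.conductorNorm ℤ : ℝ) ^ ((6 : ℝ) + 1) :=
    (hC W).trans (mul_le_mul_of_nonneg_right (le_max_left _ _) (Real.rpow_nonneg hN.le _))
  have hM : (0 : ℝ) < max C 1 := lt_of_lt_of_le one_pos (le_max_right _ _)
  have := Real.log_le_log hΔ h2
  rw [Real.log_mul hM.ne' (Real.rpow_pos_of_pos hN _).ne', Real.log_rpow hN] at this
  linarith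

/-- **abc ⇒ A-PS**: the summit statement `ABC` (strict form) gives the `≤`-form of abc, hence Szpiro `6+ε`
(`szpiro_of_abcLe_holds`, PROVED in the tree; Silverman AEC VIII.11.5(b)), hence A-PS (`K = 7`). The converse
fails for large `K`: A-PS is NOT abc. [cite: SilvermanAEC2009, Prop. VIII.11.5(b)] -/
theorem polySzpiroRat_of_abc (h : _root_.ABC) : PolySzpiroRat := by
  refine polySzpiroRat_of_szpiro (szpiro_of_abcLe_holds fun ε hε => ?_)
  obtain ⟨C, -, hC⟩ := ABC_iff.mp h ε hε
  exact ⟨C, fun a b c t => (hC a b c t).le⟩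

end Summit.ABC
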